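import Literature.AnabelianGeometry.EtaleTheta.SettingModelTateTwistFamilyProp15iii
import Literature.AnabelianGeometry.EtaleTheta.SettingModelTateTwistedInvClauses
import HarnessLib

/-!
# The stage-2 («Tate shear») model of [EtTh] §1 on the line `j = 2`: the inversion clauses of Prop. 1.5 (iii) for the
# twist family along the RE-CENTRED inversions `ι_n := Inn(σ₀^n) ∘ ι` — clause (a) exact at `n = −m` for EVERY twist,
# clause (b) exact at `n = 1 − i`; `InvClauses` for `η_{i−1}` along `ι_{1−i}` (proof-only; census)

S. Mochizuki, *The étale theta function and its Frobenioid-theoretic manifestations*, Publ. RIMS **45** (2009) [EtTh], §1,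
Prop. 1.5 (iii), PRIMS PDF p. 23 (printed 249): «Similarly, any inversion automorphism ι of Π^tp_Y — i.e., an automorphism
lying over the action of “−1” on the underlying elliptic curve of X^log which fixes the irreducible component of the special
fiber of Y labeled 0 — fixes η̈^Θ + log(O^×_K̈), but maps log(Ü) + log(O^×_K̈) to −log(Ü) + log(O^×_K̈)»
[cite: MochizukiEtTh2009, Prop 1.5 (iii) p.23].  abc-iut cell, layer L2, seat abc-iut-L2-t12 (gen 11); row «TWIST-FAMILY@stage-2»,
file (C) (over (A) `SettingModelTateDeckIterates`, (B) `SettingModelTateTwistFamilyProp15iii`, and gen 10's p505401 / p505869).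
PROOF-ONLY: no definition, no instance, no `Prop` fact; everything BY NAME — abc-iut-L2-t1's `transport` /
`IsInversionAut.transport_trans_conj` (p505401, generic re-centring), abc-iut-L2-d1's `isInversionAut_inversionχq` /
`transport_etaDdχq` / `nonempty_thetaCompanion_inversionχq`, gen 10's `transport_trans_conj_eq_self_of_mem_kumUnitsYdd` (unit classes
are fixed, every `τ ∈ Δ^tp_X`), abc-iut-L2-t8's `inflTheta_conj_toTheta`, this seat's gen-5 `inflTheta_injective`, file (A)'s
`transport_inflTheta_logUdd_kummerCoreχq_gen` / `conj_toTheta_zpow_deckGen_logUdd` / `conj_toTheta_zpow_deckGen_zClassYddχq` /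
`conj_toTheta_zpow_deckGen_kumYdd_qddUnit`.

THE RECORD: p505869 (gen 10) = the point `(i, m, n) = (2, 1, −1)`.  THIS FILE (numbers, not a side), at `modelχq p i 2`
(every `p`, `i`), `L = log(Ü)`, `Q = κ̈(q̈)`, `η_m = η̈♯ · infl(L)^m`, `ι_n = Inn(σ₀^n) ∘ ι` (an `IsInversionAut` with a theta
companion for every `n`, `isInversionAut_inversionχq_recentredPow` — all `(i, j)`), EVERY theta companion of `ι_n`:
* **`transport_recentredPow_inflTheta_logUdd`** — `ι_{n,*} infl(L) = infl(L)^{−1} · infl(Q)^{1 − i − n}`: clause (b) is EXACT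
  iff `n = 1 − i` (`transport_recentredLine_inflTheta_logUdd`);
* **`transport_recentredPow_etaDdTwistPow`** — `ι_{n,*} η_m = η̈♯ · infl(L)^{−2n − m} · infl(Q)^{−(n(n−1) + n·i) − n·m + m(1−i)}`; at
  `n = −m` this is `η_m` EXACTLY for EVERY `m` (`transport_recentredNeg_etaDdTwistPow`: clause (a) never obstructs), and on
  the line `(n, m) = (1 − i, i − 1)` both clauses are exact (`transport_recentredLine_etaDdTwistPow`);
* **`invClauses_etaDdTwistPow_recentredLine`** — `InvClauses (E_s(η_{i−1})) (IsInversionAut ι_{1−i}) c` for EVERY Galois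
  section `s` and EVERY companion `c` (clause (a) pointwise on the torsor, clause (b) with `u := 1`).
NOT CLAIMED: `Prop15iiiInv` (all cusp-fixing inversions); anything off the line `j = 2` beyond file (A)'s defect formula.
HONEST FRAMING: SEMI-SYNTHETIC model — consistency / non-vacuity evidence for the typed interface ONLY; print's inversion is
«an» automorphism over `[−1]`, determined up to `Δ^tp_X`-inner re-centring; [EtTh] is refereed and nothing of it is disputed or
asserted; typed ≠ proved; inhabited-at-a-model ≠ proved; no side taken on [IUTchIII] Cor. 3.12.
-/

noncomputable section

namespace Literature.AnabelianGeometry.EtaleTheta.SettingModel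

open Literature.AnabelianGeometry.SemiGraphs Literature.AnabelianGeometry.AbsoluteAnabelian

variable (p : ℕ) [Fact p.Prime] (i j : ℤ)

/-! ### The re-centred inversions `ι_n = Inn(σ₀^n) ∘ ι` (every `(i, j)`, every `n`) -/

/-- **`ι_n := Inn(σ₀^n) ∘ ι` is an inversion automorphism** (Prop. 1.5 (iii)) of `modelχq p i j`, every `n ∈ ℤ`
(p505401's `IsInversionAut.trans_conj`; `n = −1` is gen 10's `ι′`). [cite: MochizukiEtTh2009, Prop 1.5 (iii) p.23] -/
theorem isInversionAut_inversionχq_recentredPow (hj : Even j) (n : ℤ) :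
    (ThetaSetting.modelχq p i j hj).IsInversionAut ((inversionχq p i j).trans
      (conjContinuousMulEquiv ((SemidirectProduct.inl (gfpOf (FreeGroup.of 0)) : PiTpχq p i j) ^ n))) :=
  isInversionAut_inversionχq_trans_conj p i j hj (aug_inl_zpow p i j hj _ n)

/-- A theta companion of `ι_n` exists (abc-iut's `thetaCompanionOfAut`). [cite: MochizukiEtTh2009, Thm 1.6 (ii) p.24] -/
theorem nonempty_thetaCompanion_inversionχq_recentredPow (hj : Even j) (n : ℤ) :
    Nonempty (ThetaSetting.ThetaCompanion (Dα := ThetaSetting.modelχq p i j hj) (Dβ := ThetaSetting.modelχq p i j hj)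
      ((inversionχq p i j).trans
        (conjContinuousMulEquiv ((SemidirectProduct.inl (gfpOf (FreeGroup.of 0)) : PiTpχq p i j) ^ n)))) :=
  ⟨(ThetaSetting.modelχq p i j hj).thetaCompanionOfAut _ (isInversionAut_inversionχq_recentredPow p i j hj n).map_deltaTemp
    (hasThetaTopology_modelχq p i j hj).isQuotientMap_toTheta⟩

/-! ### Transports along `ι_n` on the line `j = 2` -/

section LineTwo

variable (hC : (ThetaSetting.modelχq p i 2 even_two).Compat) (n : ℤ)
  (c' : ThetaSetting.ThetaCompanion (Dα := ThetaSetting.modelχq p i 2 even_two) (Dβ := ThetaSetting.modelχq p i 2 even_two)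
    ((inversionχq p i 2).trans
      (conjContinuousMulEquiv ((SemidirectProduct.inl (gfpOf (FreeGroup.of 0)) : PiTpχq p i 2) ^ n))))

/-- Commutative-group bookkeeping for the transport of `log(Ü)`. [folklore] -/
private theorem logUdd_transport_algebra {M : Type*} [CommGroup M] (L Q : M) (i n : ℤ) :
    (L * Q ^ n)⁻¹ * Q ^ ((2 : ℤ) / 2 - i) = L⁻¹ * Q ^ (1 - i - n) := by
  rw [show (2 : ℤ) / 2 = 1 by decide]
  apply Additive.ofMul.injective
  simp only [ofMul_mul, ofMul_zpow, ofMul_inv]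
  module

include hC in
/-- **`ι_{n,*} infl(log Ü) = infl(log Ü)^{−1} · infl(κ̈(q̈))^{1 − i − n}`** at `modelχq p i 2` (every `i`, `n`, every companion of
`ι_n`): the defect `κ̈(q̈)^{1−i}` of `ι` (file (A)) shifted by `σ₀^n·log(Ü) = log(Ü)·κ̈(q̈)^n`. [cite: MochizukiEtTh2009, Prop 1.5 (iii) p.23] -/
theorem transport_recentredPow_inflTheta_logUdd :
    ThetaSetting.transport c' (isInversionAut_inversionχq_recentredPow p i 2 even_two n).thm16i
        ((ThetaSetting.modelχq p i 2 even_two).inflTheta (ThetaSetting.modelχq p i 2 even_two).GtpYdd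
          (kummerCoreχq p i 2 even_two).logUdd) =
      ((ThetaSetting.modelχq p i 2 even_two).inflTheta (ThetaSetting.modelχq p i 2 even_two).GtpYdd
          (kummerCoreχq p i 2 even_two).logUdd)⁻¹ *
        (ThetaSetting.modelχq p i 2 even_two).inflTheta (ThetaSetting.modelχq p i 2 even_two).GtpYdd
          ((kummerCoreχq p i 2 even_two).toKummerData.kumYdd
            ((kummerCoreχq p i 2 even_two).toKummerData.toKddHat (ThetaSetting.modelχq p i 2 even_two).qddUnit)) ^
          (1 - i - n) := by
  haveI := hC.GtpYdd_normal
  haveI := hC.GtpYddTheta_normal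
  obtain ⟨c₀⟩ := nonempty_thetaCompanion_inversionχq p i 2 even_two
  rw [(isInversionAut_inversionχq p i 2 even_two).transport_trans_conj c₀ (aug_inl_zpow p i 2 even_two _ n) c' hC,
    transport_inflTheta_logUdd_kummerCoreχq_gen p i 2 even_two c₀, map_mul, map_inv, map_zpow,
    ← ThetaSetting.inflTheta_conj_toTheta hC, ← ThetaSetting.inflTheta_conj_toTheta hC,
    conj_toTheta_zpow_deckGen_logUdd p i hC n, conj_toTheta_zpow_deckGen_kumYdd_qddUnit p i 2 even_two hC n, map_mul, map_zpow]
  exact logUdd_transport_algebra _ _ i n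

/-- Commutative-group bookkeeping for the transport of the twisted class. [folklore] -/
private theorem twist_transport_algebra {M : Type*} [CommGroup M] (x L Q : M) (i n m : ℤ) :
    x * L ^ (-(2 * n)) * Q ^ (-(n * (n - 1) + n * i)) * ((L * Q ^ n)⁻¹ * Q ^ ((2 : ℤ) / 2 - i)) ^ m =
      x * L ^ (-(2 * n) - m) * Q ^ (-(n * (n - 1) + n * i) - n * m + m * (1 - i)) := by
  rw [show (2 : ℤ) / 2 = 1 by decide]
  apply Additive.ofMul.injective
  simp only [ofMul_mul, ofMul_zpow, ofMul_inv]
  module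

include hC in
/-- **`ι_{n,*} η_m = η̈♯ · infl(log Ü)^{−2n − m} · infl(κ̈(q̈))^{−(n(n−1) + n·i) − n·m + m(1−i)}`** at `modelχq p i 2` for the twisted class
`η_m = η̈♯ · infl(log Ü)^m` (every `i`, `n`, `m`, every companion): `ι` fixes `η̈♯` (abc-iut-L2-d1's `transport_etaDdχq`) and carries
`infl(log Ü)` to `infl(log Ü)^{−1}·infl(κ̈(q̈))^{1−i}`; then `σ₀^n` acts by file (A)'s iterated displays. [cite: MochizukiEtTh2009, Prop 1.5 (iii) p.23] -/
theorem transport_recentredPow_etaDdTwistPow (m : ℤ) :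
    ThetaSetting.transport c' (isInversionAut_inversionχq_recentredPow p i 2 even_two n).thm16i
        (etaDdχq p i 2 even_two *
          (ThetaSetting.modelχq p i 2 even_two).inflTheta (ThetaSetting.modelχq p i 2 even_two).GtpYdd
            (kummerCoreχq p i 2 even_two).logUdd ^ m) =
      etaDdχq p i 2 even_two *
        (ThetaSetting.modelχq p i 2 even_two).inflTheta (ThetaSetting.modelχq p i 2 even_two).GtpYdd
          (kummerCoreχq p i 2 even_two).logUdd ^ (-(2 * n) - m) *
        (ThetaSetting.modelχq p i 2 even_two).inflTheta (ThetaSetting.modelχq p i 2 even_two).GtpYdd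
          ((kummerCoreχq p i 2 even_two).toKummerData.kumYdd
            ((kummerCoreχq p i 2 even_two).toKummerData.toKddHat (ThetaSetting.modelχq p i 2 even_two).qddUnit)) ^
          (-(n * (n - 1) + n * i) - n * m + m * (1 - i)) := by
  haveI := hC.GtpYdd_normal
  haveI := hC.GtpYddTheta_normal
  obtain ⟨c₀⟩ := nonempty_thetaCompanion_inversionχq p i 2 even_two
  rw [(isInversionAut_inversionχq p i 2 even_two).transport_trans_conj c₀ (aug_inl_zpow p i 2 even_two _ n) c' hC,
    map_mul, map_zpow, transport_etaDdχq p i 2 even_two c₀, transport_inflTheta_logUdd_kummerCoreχq_gen p i 2 even_two c₀,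
    map_mul, map_zpow, map_mul, map_inv, map_zpow, etaDdχq_def, ← ThetaSetting.inflTheta_conj_toTheta hC,
    ← ThetaSetting.inflTheta_conj_toTheta hC, ← ThetaSetting.inflTheta_conj_toTheta hC,
    conj_toTheta_zpow_deckGen_zClassYddχq p i hC n, conj_toTheta_zpow_deckGen_logUdd p i hC n,
    conj_toTheta_zpow_deckGen_kumYdd_qddUnit p i 2 even_two hC n, map_mul, map_mul, map_zpow, map_zpow, map_mul, map_zpow]
  exact twist_transport_algebra _ _ _ i n m

end LineTwo

/-! ### The exact cases: `n = −m` (clause (a), every twist) and the line `(n, m) = (1 − i, i − 1)` (both clauses) -/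

section Exact

variable (hC : (ThetaSetting.modelχq p i 2 even_two).Compat)

include hC in
/-- **Clause (a) NEVER obstructs in the twist family: `ι_{−m,*} η_m = η_m` EXACTLY** at `modelχq p i 2` (every `i`, every `m`,
every companion of `ι_{−m}`) — the `κ̈(q̈)`-exponent `−(m(m+1) − m·i) + m² + m(1−i)` vanishes identically (gen 10's `ι′` is
`m = 1` at `i = 2`). [cite: MochizukiEtTh2009, Prop 1.5 (iii) p.23] -/
theorem transport_recentredNeg_etaDdTwistPow (m : ℤ)
    (c' : ThetaSetting.ThetaCompanion (Dα := ThetaSetting.modelχq p i 2 even_two) (Dβ := ThetaSetting.modelχq p i 2 even_two)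
      ((inversionχq p i 2).trans
        (conjContinuousMulEquiv ((SemidirectProduct.inl (gfpOf (FreeGroup.of 0)) : PiTpχq p i 2) ^ (-m))))) :
    ThetaSetting.transport c' (isInversionAut_inversionχq_recentredPow p i 2 even_two (-m)).thm16i
        (etaDdχq p i 2 even_two *
          (ThetaSetting.modelχq p i 2 even_two).inflTheta (ThetaSetting.modelχq p i 2 even_two).GtpYdd
            (kummerCoreχq p i 2 even_two).logUdd ^ m) =
      etaDdχq p i 2 even_two *
        (ThetaSetting.modelχq p i 2 even_two).inflTheta (ThetaSetting.modelχq p i 2 even_two).GtpYdd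
          (kummerCoreχq p i 2 even_two).logUdd ^ m := by
  rw [transport_recentredPow_etaDdTwistPow p i hC (-m) c' m, show -(2 * -m) - m = m by ring,
    show -(-m * (-m - 1) + -m * i) - -m * m + m * (1 - i) = 0 by ring, zpow_zero, mul_one]

variable (c' : ThetaSetting.ThetaCompanion (Dα := ThetaSetting.modelχq p i 2 even_two) (Dβ := ThetaSetting.modelχq p i 2 even_two)
    ((inversionχq p i 2).trans
      (conjContinuousMulEquiv ((SemidirectProduct.inl (gfpOf (FreeGroup.of 0)) : PiTpχq p i 2) ^ (1 - i)))))

include hC in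
/-- **On the line: `ι_{1−i,*} infl(log Ü) = infl(log Ü)^{−1}` EXACTLY** at `modelχq p i 2` (every `i`, every companion of `ι_{1−i}`).
[cite: MochizukiEtTh2009, Prop 1.5 (iii) p.23] -/
theorem transport_recentredLine_inflTheta_logUdd :
    ThetaSetting.transport c' (isInversionAut_inversionχq_recentredPow p i 2 even_two (1 - i)).thm16i
        ((ThetaSetting.modelχq p i 2 even_two).inflTheta (ThetaSetting.modelχq p i 2 even_two).GtpYdd
          (kummerCoreχq p i 2 even_two).logUdd) =
      ((ThetaSetting.modelχq p i 2 even_two).inflTheta (ThetaSetting.modelχq p i 2 even_two).GtpYdd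
          (kummerCoreχq p i 2 even_two).logUdd)⁻¹ := by
  rw [transport_recentredPow_inflTheta_logUdd p i hC (1 - i) c', show (1 : ℤ) - i - (1 - i) = 0 by ring, zpow_zero, mul_one]

include hC in
/-- **On the line: `ι_{1−i,*} η_{i−1} = η_{i−1}` EXACTLY** at `modelχq p i 2` (every `i`, every companion of `ι_{1−i}`).
[cite: MochizukiEtTh2009, Prop 1.5 (iii) p.23] -/
theorem transport_recentredLine_etaDdTwistPow :
    ThetaSetting.transport c' (isInversionAut_inversionχq_recentredPow p i 2 even_two (1 - i)).thm16i
        (etaDdχq p i 2 even_two *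
          (ThetaSetting.modelχq p i 2 even_two).inflTheta (ThetaSetting.modelχq p i 2 even_two).GtpYdd
            (kummerCoreχq p i 2 even_two).logUdd ^ (i - 1)) =
      etaDdχq p i 2 even_two *
        (ThetaSetting.modelχq p i 2 even_two).inflTheta (ThetaSetting.modelχq p i 2 even_two).GtpYdd
          (kummerCoreχq p i 2 even_two).logUdd ^ (i - 1) := by
  rw [transport_recentredPow_etaDdTwistPow p i hC (1 - i) c' (i - 1), show -(2 * (1 - i)) - (i - 1) = i - 1 by ring,
    show -((1 - i) * (1 - i - 1) + (1 - i) * i) - (1 - i) * (i - 1) + (i - 1) * (1 - i) = 0 by ring, zpow_zero, mul_one]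

include hC in
/-- **Clause (b), every intertwiner**: an automorphism `T` of `H¹((Π^tp_Ÿ)^Θ, Δ_Θ)` intertwining the transport along `ι_{1−i}`
through inflation sends `log(Ü)` to `log(Ü)^{−1}` EXACTLY (`inflTheta_injective`). [cite: MochizukiEtTh2009, Prop 1.5 (iii) p.23] -/
theorem apply_logUdd_eq_inv_recentredLine
    (T : (ThetaSetting.modelχq p i 2 even_two).H1Theta
        ((ThetaSetting.modelχq p i 2 even_two).GtpYdd.map (ThetaSetting.modelχq p i 2 even_two).toTheta) ≃*
      (ThetaSetting.modelχq p i 2 even_two).H1Theta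
        ((ThetaSetting.modelχq p i 2 even_two).GtpYdd.map (ThetaSetting.modelχq p i 2 even_two).toTheta))
    (hT : ∀ z, (ThetaSetting.modelχq p i 2 even_two).inflTheta (ThetaSetting.modelχq p i 2 even_two).GtpYdd (T z) =
      ThetaSetting.transport c' (isInversionAut_inversionχq_recentredPow p i 2 even_two (1 - i)).thm16i
        ((ThetaSetting.modelχq p i 2 even_two).inflTheta (ThetaSetting.modelχq p i 2 even_two).GtpYdd z)) :
    T (kummerCoreχq p i 2 even_two).logUdd = ((kummerCoreχq p i 2 even_two).logUdd)⁻¹ := by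
  apply (ThetaSetting.modelχq p i 2 even_two).inflTheta_injective (ThetaSetting.modelχq p i 2 even_two).GtpYdd
  rw [hT, map_inv, transport_recentredLine_inflTheta_logUdd p i hC c']

variable (s : GQp p →* PiTpχq p i 2) (hs : Continuous s)
  (hsec : ∀ σ : GQp p, (ThetaSetting.modelχq p i 2 even_two).aug (s σ) = σ)
  (hsY : (ThetaSetting.modelχq p i 2 even_two).GK.map s ≤ (ThetaSetting.modelχq p i 2 even_two).GtpY)
  (hsYdd : (ThetaSetting.modelχq p i 2 even_two).GKdd.map s ≤ (ThetaSetting.modelχq p i 2 even_two).GtpYdd)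

include hC in
/-- **[EtTh] Prop. 1.5 (iii), inversion clauses, WITNESSED at `modelχq p i 2` (every `i`) for the twisted datum `E_s(η_{i−1})`**
over the section Kummer datum of ANY Galois section `s`, the re-centred inversion `ι_{1−i} = Inn(σ₀^{1−i}) ∘ ι` and EVERY theta
companion of it: `ι_{1−i}` fixes `η_{i−1} + log(O^×_K̈)` pointwise and sends `log(Ü)` to `−log(Ü)` (`u := 1`).  (gen 10's p505869 =
`i = 2`; abc-iut-L2-d1's record at `(1, 2)` = `i = 1`, `ι` itself.) [cite: MochizukiEtTh2009, Prop 1.5 (iii) p.23] -/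
theorem invClauses_etaDdTwistPow_recentredLine :
    ThetaSetting.InvClauses
      (((kummerCoreχq p i 2 even_two).toKummerDataOfSection s hs hsec hsY hsYdd).etaleThetaDataOfClass
        (etaDdχq p i 2 even_two *
          (ThetaSetting.modelχq p i 2 even_two).inflTheta (ThetaSetting.modelχq p i 2 even_two).GtpYdd
            (kummerCoreχq p i 2 even_two).logUdd ^ (i - 1)))
      (isInversionAut_inversionχq_recentredPow p i 2 even_two (1 - i)) c' where
  image_thetaClasses := by
    have hfix : ∀ x ∈ (((kummerCoreχq p i 2 even_two).toKummerDataOfSection s hs hsec hsY hsYdd).etaleThetaDataOfClass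
        (etaDdχq p i 2 even_two *
          (ThetaSetting.modelχq p i 2 even_two).inflTheta (ThetaSetting.modelχq p i 2 even_two).GtpYdd
            (kummerCoreχq p i 2 even_two).logUdd ^ (i - 1))).thetaClasses,
        ThetaSetting.transport c' (isInversionAut_inversionχq_recentredPow p i 2 even_two (1 - i)).thm16i x = x := by
      rintro x ⟨k, hk, rfl⟩
      rw [map_mul, transport_trans_conj_eq_self_of_mem_kumUnitsYdd p i 2 even_two hC (aug_inl_zpow p i 2 even_two _ _) c'
        s hs hsec hsY hsYdd hk]
      exact congrArg (k * ·) (transport_recentredLine_etaDdTwistPow p i hC c')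
    ext x
    constructor
    · rintro ⟨y, hy, rfl⟩
      rw [hfix y hy]
      exact hy
    · intro hx
      exact ⟨x, hx, hfix x hx⟩
  logUdd_inv T hT := ⟨1, Subgroup.one_mem _, by
    rw [map_one, map_one, mul_one]
    exact apply_logUdd_eq_inv_recentredLine p i hC c' T hT⟩

end Exact

end Literature.AnabelianGeometry.EtaleTheta.SettingModel

end
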